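import Summits.NavierStokesRegularity.NavierStokesRegularity.Theorems.IsobarTomographyIsobaricLinesLiouvilleHullReductionSix
import HarnessLib

/-!
# The swirling axisymmetric case of the crux `IsobaricLinesLiouville` (stmt-NavierStokesRegularity-11741), modulo two named statements

Supports the crux (lead c2, line `Ideator2Sketch`). Hull (G) of the line's analysis — bounded ancient
mild solutions with isobaric vortex lines which are infinitesimally AXISYMMETRIC about a fixed axis,
swirl allowed — is reduced here, in the tree, to exactly two statements that the exact local
computations of the crux directory single out (`AxiRigidity-c2.md`, REV 4–8; `Synthesis-c2.md`):

* the **axisymmetric isobaric trichotomy** `(T)`: for such a solution, either the pressure is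
  spatially constant at all `t < 0`, or there is no swirl about the axis at all `t < 0`, or the
  velocity changes along the axis direction `e` only by multiples of `e` at all `t < 0` (the shear
  hull (B′)). This is the global, all-times form of the conjecture (G-ancient-local) — near columnar
  and z-linear swirling flows the space-time isobaric jet variety is, exactly and N-stably for
  weighted orders 14–22, the time-dependent z-linear class `u = h(r,t)`, `w = z f(r,t) + g(r,t)`,
  `v_θ = V(r,t)` (tangent windows `4w + 4`, no z-dependent swirl; kit j024068) — combined with the
  space- and time-analyticity of bounded ancient mild solutions;
* the **constant-pressure Liouville statement** `(HP)`: a bounded ancient mild solution whose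
  pressure gradient vanishes identically is constant on every slice (open; the 2- and
  2½-dimensional cases reduce to the heat equation through `det ∇v_h = 0`).

`sliceConst_of_axisymSwirl_of` : `(HP) → (T) →` hull (G) is slice-wise constant, by the landed leaves
`sliceConst_of_axisym` (no swirl, KNSS Thm 5.2) and `stub_shearTranslationLeaf` (shear hull).
Both hypotheses are stated inline (no new definitions); the theorem is CONDITIONAL on them and says so.
Sources: Koch–Nadirashvili–Seregin–Šverák 2009 (arXiv:0709.3599) Thms 5.1–5.2 (through the leaves).
-/

noncomputable section

-- the summit and its single problem share the name (D-0017 nested layout)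
set_option linter.dupNamespace false

namespace Summit.NavierStokesRegularity.NavierStokesRegularity.Theorems.IsobaricLinesLiouville.FluxSurfacePersistence

open scoped InnerProductSpace RealInnerProductSpace Topology ContDiff
open Literature.Analysis.FluidPDE Set Function
open Summit.NavierStokesRegularity.NavierStokesRegularity.Theses.IsobarTomography

/-- **Hull (G) modulo `(HP)` and the trichotomy `(T)`.** If `(HP)` bounded ancient mild solutions
with identically vanishing pressure gradient are slice-wise constant, and `(T)` every isobaric
bounded ancient mild solution infinitesimally axisymmetric about a fixed axis `(c, e)` has, at all
`t < 0` simultaneously, constant pressure, or no swirl about the axis, or velocity changing along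
`e` only by multiples of `e`, then every isobaric bounded ancient mild solution infinitesimally
axisymmetric about a fixed axis — swirl allowed — is constant on every slice (`sliceConst_of_axisym`
for the swirl-free alternative, `stub_shearTranslationLeaf` for the shear alternative). -/
theorem sliceConst_of_axisymSwirl_of
    (hHP : ∀ (v : ℝ → EuclideanSpace ℝ (Fin 3) → EuclideanSpace ℝ (Fin 3))
      (q : ℝ → EuclideanSpace ℝ (Fin 3) → ℝ),
      IsBoundedAncientMildSolution 1 v → IsClassicalNSSolutionOn (Set.Iio 0) 1 0 v q →
        (∀ t < 0, ∀ x : EuclideanSpace ℝ (Fin 3), gradient (q t) x = 0) →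
          ∀ t < 0, ∃ b : EuclideanSpace ℝ (Fin 3), v t = fun _ => b)
    (hT : ∀ (v : ℝ → EuclideanSpace ℝ (Fin 3) → EuclideanSpace ℝ (Fin 3))
      (q : ℝ → EuclideanSpace ℝ (Fin 3) → ℝ),
      IsBoundedAncientMildSolution 1 v → IsClassicalNSSolutionOn (Set.Iio 0) 1 0 v q →
        (∀ t < 0, ∀ x : EuclideanSpace ℝ (Fin 3), ⟪curl (v t) x, gradient (q t) x⟫_ℝ = 0) →
          ∀ (e c : EuclideanSpace ℝ (Fin 3)), e ≠ 0 →
            (∀ t < 0, ∀ x : EuclideanSpace ℝ (Fin 3),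
                fderiv ℝ (v t) x (cross e (x - c)) = cross e (v t x)) →
              (∀ t < 0, ∀ x : EuclideanSpace ℝ (Fin 3), gradient (q t) x = 0) ∨
              (∀ t < 0, ∀ x : EuclideanSpace ℝ (Fin 3), ⟪v t x, cross e (x - c)⟫_ℝ = 0) ∨
              (∀ t < 0, ∀ (x : EuclideanSpace ℝ (Fin 3)) (δ : ℝ), ∃ μ : ℝ,
                  v t (x + δ • e) - v t x = μ • e))
    (v : ℝ → EuclideanSpace ℝ (Fin 3) → EuclideanSpace ℝ (Fin 3))
    (q : ℝ → EuclideanSpace ℝ (Fin 3) → ℝ)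
    (hanc : IsBoundedAncientMildSolution 1 v) (hcl : IsClassicalNSSolutionOn (Set.Iio 0) 1 0 v q)
    (hiso : ∀ t < 0, ∀ x : EuclideanSpace ℝ (Fin 3), ⟪curl (v t) x, gradient (q t) x⟫_ℝ = 0)
    (e c : EuclideanSpace ℝ (Fin 3)) (he : e ≠ 0)
    (hkill : ∀ t < 0, ∀ x : EuclideanSpace ℝ (Fin 3),
      fderiv ℝ (v t) x (cross e (x - c)) = cross e (v t x)) :
    ∀ t < 0, ∃ b : EuclideanSpace ℝ (Fin 3), v t = fun _ => b := by
  rcases hT v q hanc hcl hiso e c he hkill with hq | hns | hsh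
  · exact hHP v q hanc hcl hq
  · exact sliceConst_of_axisym v q hanc hcl e c he hkill hns
  · exact stub_shearTranslationLeaf v q hanc hcl e he hsh

/-- Registered tools stub of line `Ideator2Sketch` (`ledger workitem stub-add … --name stub_axisymSwirlTools`):
hull (G) modulo `(HP)` and `(T)`, by name. -/
theorem stub_axisymSwirlTools :
    (∀ (v : ℝ → EuclideanSpace ℝ (Fin 3) → EuclideanSpace ℝ (Fin 3))
      (q : ℝ → EuclideanSpace ℝ (Fin 3) → ℝ),
      IsBoundedAncientMildSolution 1 v → IsClassicalNSSolutionOn (Set.Iio 0) 1 0 v q →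
        (∀ t < 0, ∀ x : EuclideanSpace ℝ (Fin 3), gradient (q t) x = 0) →
          ∀ t < 0, ∃ b : EuclideanSpace ℝ (Fin 3), v t = fun _ => b) →
    (∀ (v : ℝ → EuclideanSpace ℝ (Fin 3) → EuclideanSpace ℝ (Fin 3))
      (q : ℝ → EuclideanSpace ℝ (Fin 3) → ℝ),
      IsBoundedAncientMildSolution 1 v → IsClassicalNSSolutionOn (Set.Iio 0) 1 0 v q →
        (∀ t < 0, ∀ x : EuclideanSpace ℝ (Fin 3), ⟪curl (v t) x, gradient (q t) x⟫_ℝ = 0) →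
          ∀ (e c : EuclideanSpace ℝ (Fin 3)), e ≠ 0 →
            (∀ t < 0, ∀ x : EuclideanSpace ℝ (Fin 3),
                fderiv ℝ (v t) x (cross e (x - c)) = cross e (v t x)) →
              (∀ t < 0, ∀ x : EuclideanSpace ℝ (Fin 3), gradient (q t) x = 0) ∨
              (∀ t < 0, ∀ x : EuclideanSpace ℝ (Fin 3), ⟪v t x, cross e (x - c)⟫_ℝ = 0) ∨
              (∀ t < 0, ∀ (x : EuclideanSpace ℝ (Fin 3)) (δ : ℝ), ∃ μ : ℝ,
                  v t (x + δ • e) - v t x = μ • e)) →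
    ∀ (v : ℝ → EuclideanSpace ℝ (Fin 3) → EuclideanSpace ℝ (Fin 3))
      (q : ℝ → EuclideanSpace ℝ (Fin 3) → ℝ),
      IsBoundedAncientMildSolution 1 v → IsClassicalNSSolutionOn (Set.Iio 0) 1 0 v q →
        (∀ t < 0, ∀ x : EuclideanSpace ℝ (Fin 3), ⟪curl (v t) x, gradient (q t) x⟫_ℝ = 0) →
          ∀ (e c : EuclideanSpace ℝ (Fin 3)), e ≠ 0 →
            (∀ t < 0, ∀ x : EuclideanSpace ℝ (Fin 3),
                fderiv ℝ (v t) x (cross e (x - c)) = cross e (v t x)) →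
              ∀ t < 0, ∃ b : EuclideanSpace ℝ (Fin 3), v t = fun _ => b :=
  sliceConst_of_axisymSwirl_of

end Summit.NavierStokesRegularity.NavierStokesRegularity.Theorems.IsobaricLinesLiouville.FluxSurfacePersistence

end
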